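import Summits.AtomisticToContinuum.FouriersLaw.Theorems.BondHeatUncertaintySubdiffusiveBondHeatJunctionRatioBracketCalculus

/-!
# `JunctionRatioBracketPointwise` — file 22b: the OPERATOR piece [OPS] of the bracket identity [BI], part 2 — the POINTWISE identity
# `p_j²/T − 1 = A_b Ψ − L G` (cell `decomp-a2c`, lens-1 «grading / quantitative ladder», gen 65; beneath files 19b / 22a; target 11071)

With the adjoint derivatives `A_b = adjointP T b`, `B_b = adjointQ P T b` and the commutators (C1) `A_b(Lf) − L(A_b f) = B_b f + γB_b A_b f`,
(C2) `B_b(Lf) − L(B_b f) = −Σ_i Hess_{ib} A_i f` of file 22a (`…JunctionRatioBracketCalculus`), this file proves: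

* `transferTest β N b j ∈ C^∞` for `β ≥ 0`; the end columns of the Hessian of the pinned potential
  (`Σ_i Hess_{i0}a_i = (U″(q₀) + V″(q₁−q₀))a₀ − V″(q₁−q₀)a₁`, `U″ = ω₂ + 3·lam·q²`, `V″ = 1 + 3βr²`, and the cold mirror at sites `N−1, N−2`);
* **(C3)** `transferBracket_pointwise_hot/_cold`: with `ψ = transferTest β N b j`, `Ψ = transferObservable … b j` (19b, verbatim),
  `G := A_b(Lψ) + B_b ψ`:  **`p_j²/T − 1 = A_b Ψ − L G`** at EVERY phase point (`N ≥ 3`, `β ≥ 0`, `T ≠ 0`; hot `(b, j) = (0, 1)`,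
  cold `(b, j) = (N−1, N−2)`).  Assembly (`transferBracket_pointwise`, for any bath site `b` with `B_b = 1` and Hessian column
  `Σ_i Hess_{ib}a_i = κa_b − V″a_j`):  `A_bΨ − LG = [A_b(LLψ) − L(A_b Lψ)] − γA_b(Lψ) + κA_bψ − L(B_bψ) = [B_b(Lψ) − L(B_bψ)] + κA_bψ`
  (C1 at `f = Lψ`) `= −Σ_i Hess_{ib}A_iψ + κA_bψ` (C2 at `f = ψ`) `= V″·A_jψ = p_j²/T − 1` (`∂_{p_j}ψ = 1/V″`).

USE (remaining [BI] pieces of the g64 skeleton): pairing (C3) with the response density `h` gives `⟨h,p_j²⟩/T − ⟨h,1⟩ = ⟨h, A_bΨ⟩ − ⟨h, LG⟩`;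
the tap identity (extended by [EXT] to polynomially bounded smooth tests) turns `⟨h, A_bΨ⟩` into `⟨g_b ± p_b/(2T²), Ψ⟩`, [WL] turns
`⟨h, LG⟩` into the source functional `∓(γ/2T²)⟨G, p₀² − p²_{N−1}⟩`, [GIBBS] evaluates the Gibbs constants and [LINK] identifies `⟨h, p_j²⟩`
with `τ`.  FIXED-`N`; fully proved; standard axioms; imports only file 22a (hence only 19b; independent of files 21a–21f).
-/

noncomputable section

open MeasureTheory Filter Topology Set
open scoped BigOperators ContDiff

namespace Summit.AtomisticToContinuum.FouriersLaw.Theorems.SubdiffusiveBondHeat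

namespace EscapeGrading

open Literature.MathematicalPhysics.KineticTheory.HeatConduction

variable {N : ℕ}

open Summit.AtomisticToContinuum.FouriersLaw.Theorems.SuperadditiveResistance.DeviceLiouville (partialP_sub)
open Summit.AtomisticToContinuum.FouriersLaw.Theorems.OddSectorIrreversibility (generator_add)

/-! ## E. The transfer test observable `ψ = p_j / V″(q_j − q_b)` and the pointwise bracket identity (C3) -/

/-- `ψ = transferTest β N b j` is smooth for `β ≥ 0`. [calculus] -/
theorem contDiff_transferTest {β : ℝ} (hβ : 0 ≤ β) (b j : Fin N) {n : WithTop ℕ∞} :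
    ContDiff ℝ n (transferTest β N b j) := by
  unfold transferTest
  refine ContDiff.div ((contDiff_apply ℝ ℝ j).comp contDiff_snd) ?_
    fun x => (by positivity : (0 : ℝ) < 1 + 3 * β * (x.1 j - x.1 b) ^ 2).ne'
  exact contDiff_const.add (contDiff_const.mul
    ((((contDiff_apply ℝ ℝ j).comp contDiff_fst).sub ((contDiff_apply ℝ ℝ b).comp contDiff_fst)).pow 2))

/-- Diagonal Hessian entry at the hot end (`N ≥ 2`): `Hess_{00}(q) = U″(q_0) + V″(q_1 − q_0)`. [calculus] -/
theorem hessPotential_zero_zero (P : OscillatorChain) (hN : 2 ≤ N) (q : Fin N → ℝ) :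
    P.hessPotential N ⟨0, by omega⟩ ⟨0, by omega⟩ q =
      deriv (deriv P.U) (q ⟨0, by omega⟩) + deriv (deriv P.V) (q ⟨1, by omega⟩ - q ⟨0, by omega⟩) := by
  unfold OscillatorChain.hessPotential
  simp only [if_true, mul_one]
  congr 1
  have key : ∀ k l : Fin N,
      (if l.val = k.val + 1 then
        deriv (deriv P.V) (q l - q k) *
          ((if l = (⟨0, by omega⟩ : Fin N) then 1 else 0) - (if k = (⟨0, by omega⟩ : Fin N) then 1 else 0)) *
          ((if l = (⟨0, by omega⟩ : Fin N) then 1 else 0) - (if k = (⟨0, by omega⟩ : Fin N) then 1 else 0))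
        else (0 : ℝ)) =
      if k = ⟨0, by omega⟩ then (if l = ⟨1, by omega⟩ then deriv (deriv P.V) (q l - q k) else 0) else 0 := by
    intro k l
    have hk := k.isLt
    have hl := l.isLt
    simp only [Fin.ext_iff]
    split_ifs <;> first | (exfalso; omega) | simp
  simp_rw [key]
  simp

/-- Diagonal Hessian entry at the cold end (`N ≥ 2`): `Hess_{N−1,N−1}(q) = U″(q_{N−1}) + V″(q_{N−1} − q_{N−2})`.
[calculus] -/
theorem hessPotential_last_last (P : OscillatorChain) (hN : 2 ≤ N) (q : Fin N → ℝ) :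
    P.hessPotential N ⟨N - 1, by omega⟩ ⟨N - 1, by omega⟩ q =
      deriv (deriv P.U) (q ⟨N - 1, by omega⟩) +
        deriv (deriv P.V) (q ⟨N - 1, by omega⟩ - q ⟨N - 1 - 1, by omega⟩) := by
  unfold OscillatorChain.hessPotential
  simp only [if_true, mul_one]
  congr 1
  have key : ∀ k l : Fin N,
      (if l.val = k.val + 1 then
        deriv (deriv P.V) (q l - q k) *
          ((if l = (⟨N - 1, by omega⟩ : Fin N) then 1 else 0) -
            (if k = (⟨N - 1, by omega⟩ : Fin N) then 1 else 0)) *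
          ((if l = (⟨N - 1, by omega⟩ : Fin N) then 1 else 0) -
            (if k = (⟨N - 1, by omega⟩ : Fin N) then 1 else 0))
        else (0 : ℝ)) =
      if k = ⟨N - 1 - 1, by omega⟩ then
        (if l = ⟨N - 1, by omega⟩ then deriv (deriv P.V) (q l - q k) else 0) else 0 := by
    intro k l
    have hk := k.isLt
    have hl := l.isLt
    simp only [Fin.ext_iff]
    split_ifs <;> first | (exfalso; omega) | simp
  simp_rw [key]
  simp

/-- Hot-end Hessian column of the pinned chain paired with a vector (`N ≥ 2`):
`Σ_i Hess_{i0}(q) a_i = (U″(q_0) + V″(q_1 − q_0)) a_0 − V″(q_1 − q_0) a_1` with `U″(s) = ω² + 3λs²`,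
`V″(r) = 1 + 3βr²`. [calculus] -/
theorem sum_hessPotential_col_zero_mul (ω₂ lam β γ : ℝ) (hN : 2 ≤ N) (q a : Fin N → ℝ) :
    ∑ i, (pinnedChain ω₂ lam β γ).hessPotential N i ⟨0, by omega⟩ q * a i =
      (ω₂ + 3 * lam * q ⟨0, by omega⟩ ^ 2 + (1 + 3 * β * (q ⟨1, by omega⟩ - q ⟨0, by omega⟩) ^ 2)) *
          a ⟨0, by omega⟩
        - (1 + 3 * β * (q ⟨1, by omega⟩ - q ⟨0, by omega⟩) ^ 2) * a ⟨1, by omega⟩ := by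
  rw [Finset.sum_eq_add (⟨0, by omega⟩ : Fin N) ⟨1, by omega⟩ (by simp) ?_ (by simp) (by simp)]
  · rw [hessPotential_zero_zero _ hN, (pinnedChain ω₂ lam β γ).hessPotential_succ N rfl q]
    simp only [Literature.Barriers.AtomisticToContinuum.pinnedChain_deriv_deriv_U, pinnedChain_deriv_deriv_V]
    ring
  · rintro i - ⟨hi0, hi1⟩
    have hi0' : i.val ≠ 0 := fun e => hi0 (Fin.ext e)
    have hi1' : i.val ≠ 1 := fun e => hi1 (Fin.ext e)
    rw [(pinnedChain ω₂ lam β γ).hessPotential_eq_zero_of_two_le N (Or.inl ?_) q, zero_mul]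
    show 0 + 2 ≤ i.val
    omega

/-- Cold-end Hessian column of the pinned chain paired with a vector (`N ≥ 2`):
`Σ_i Hess_{i,N−1}(q) a_i = (U″(q_{N−1}) + V″(q_{N−2} − q_{N−1})) a_{N−1} − V″(q_{N−2} − q_{N−1}) a_{N−2}`. [calculus] -/
theorem sum_hessPotential_col_last_mul (ω₂ lam β γ : ℝ) (hN : 2 ≤ N) (q a : Fin N → ℝ) :
    ∑ i, (pinnedChain ω₂ lam β γ).hessPotential N i ⟨N - 1, by omega⟩ q * a i =
      (ω₂ + 3 * lam * q ⟨N - 1, by omega⟩ ^ 2 +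
            (1 + 3 * β * (q ⟨N - 1 - 1, by omega⟩ - q ⟨N - 1, by omega⟩) ^ 2)) * a ⟨N - 1, by omega⟩
        - (1 + 3 * β * (q ⟨N - 1 - 1, by omega⟩ - q ⟨N - 1, by omega⟩) ^ 2) * a ⟨N - 1 - 1, by omega⟩ := by
  have hne : (⟨N - 1, by omega⟩ : Fin N) ≠ ⟨N - 1 - 1, by omega⟩ := by
    intro e
    have h' : N - 1 = N - 1 - 1 := Fin.ext_iff.mp e
    omega
  rw [Finset.sum_eq_add (⟨N - 1, by omega⟩ : Fin N) ⟨N - 1 - 1, by omega⟩ hne ?_ (by simp) (by simp)]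
  · have hs : (⟨N - 1, by omega⟩ : Fin N).val = (⟨N - 1 - 1, by omega⟩ : Fin N).val + 1 := by
      show N - 1 = N - 1 - 1 + 1
      omega
    rw [hessPotential_last_last _ hN,
      (pinnedChain ω₂ lam β γ).hessPotential_comm N ⟨N - 1 - 1, by omega⟩ ⟨N - 1, by omega⟩ q,
      (pinnedChain ω₂ lam β γ).hessPotential_succ N hs q]
    simp only [Literature.Barriers.AtomisticToContinuum.pinnedChain_deriv_deriv_U, pinnedChain_deriv_deriv_V]
    ring
  · rintro i - ⟨hia, hib⟩
    have hi := i.isLt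
    have hia' : i.val ≠ N - 1 := fun e => hia (Fin.ext e)
    have hib' : i.val ≠ N - 1 - 1 := fun e => hib (Fin.ext e)
    rw [(pinnedChain ω₂ lam β γ).hessPotential_eq_zero_of_two_le N (Or.inr ?_) q, zero_mul]
    show i.val + 2 ≤ N - 1
    omega

/-- **(C3) pointwise bracket identity** at a bath site `b` (`B_b = 1`) with neighbour `j`, for the pinned chain
at temperature `T ≠ 0`, `β ≥ 0`: with `ψ = transferTest β N b j = p_j/V″(q_j − q_b)`,
`Ψ = transferObservable … b j = L(Lψ) − γLψ + κψ` and `G = A_b(Lψ) + B_b ψ`,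
**`p_j²/T − 1 = A_b Ψ − L G`**, provided the Hessian column of `b` is `κ δ_{·b} − V″ δ_{·j}` (`hcol`; this is
where `b` is an end site and `j` its neighbour).  Assembled from (C1) at `f = Lψ`, (C2) at `f = ψ` and
`V″·A_j ψ = p_j²/T − 1`. [calculus] -/
theorem transferBracket_pointwise (ω₂ lam β γ : ℝ) {T : ℝ} (hT : T ≠ 0) (hβ : 0 ≤ β) (b j : Fin N)
    (hB : OscillatorChain.bathWeight N b = 1) (x : PhaseSpace N)
    (hcol : ∀ a : Fin N → ℝ, ∑ i, (pinnedChain ω₂ lam β γ).hessPotential N i b x.1 * a i =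
      (ω₂ + 3 * lam * x.1 b ^ 2 + (1 + 3 * β * (x.1 j - x.1 b) ^ 2)) * a b
        - (1 + 3 * β * (x.1 j - x.1 b) ^ 2) * a j) :
    x.2 j ^ 2 / T - 1 =
      adjointP T b (transferObservable ω₂ lam β γ T N b j) x
        - (pinnedChain ω₂ lam β γ).generator N T T (fun y =>
            adjointP T b ((pinnedChain ω₂ lam β γ).generator N T T (transferTest β N b j)) y
              + adjointQ (pinnedChain ω₂ lam β γ) T b (transferTest β N b j) y) x := by
  have hψ3 : ContDiff ℝ 3 (transferTest β N b j) := contDiff_transferTest hβ b j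
  have hLψ : ContDiff ℝ 3 ((pinnedChain ω₂ lam β γ).generator N T T (transferTest β N b j)) :=
    contDiff_generator_of_contDiff _ (pinnedChain_contDiff_U ω₂ lam β γ) (pinnedChain_contDiff_V ω₂ lam β γ)
      T T (contDiff_transferTest hβ b j (n := 5)) (m := 3) (by norm_num)
  have hLLψ : ContDiff ℝ 1 ((pinnedChain ω₂ lam β γ).generator N T T
      ((pinnedChain ω₂ lam β γ).generator N T T (transferTest β N b j))) :=
    contDiff_generator_of_contDiff _ (pinnedChain_contDiff_U ω₂ lam β γ) (pinnedChain_contDiff_V ω₂ lam β γ)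
      T T hLψ (m := 1) (by norm_num)
  have dψ : Differentiable ℝ (transferTest β N b j) := hψ3.differentiable (by norm_num)
  have dL : Differentiable ℝ ((pinnedChain ω₂ lam β γ).generator N T T (transferTest β N b j)) :=
    hLψ.differentiable (by norm_num)
  have dLL : Differentiable ℝ ((pinnedChain ω₂ lam β γ).generator N T T
      ((pinnedChain ω₂ lam β γ).generator N T T (transferTest β N b j))) :=
    hLLψ.differentiable (by norm_num)
  have hVne : (1 + 3 * β * (x.1 j - x.1 b) ^ 2) ≠ 0 :=
    (by positivity : (0 : ℝ) < 1 + 3 * β * (x.1 j - x.1 b) ^ 2).ne'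
  -- (1) `A_b Ψ = A_b(LLψ) − γ A_b(Lψ) + κ A_b ψ`
  have hκψ : partialP b (fun y : PhaseSpace N =>
      (ω₂ + 3 * lam * y.1 b ^ 2 + (1 + 3 * β * (y.1 j - y.1 b) ^ 2)) * transferTest β N b j y) x =
      (ω₂ + 3 * lam * x.1 b ^ 2 + (1 + 3 * β * (x.1 j - x.1 b) ^ 2)) * partialP b (transferTest β N b j) x := by
    unfold partialP
    show deriv (fun t => (ω₂ + 3 * lam * x.1 b ^ 2 + (1 + 3 * β * (x.1 j - x.1 b) ^ 2)) *
      transferTest β N b j (x.1, Function.update x.2 b t)) (x.2 b) = _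
    exact deriv_const_mul_field _
  have dκ : Differentiable ℝ (fun y : PhaseSpace N =>
      ω₂ + 3 * lam * y.1 b ^ 2 + (1 + 3 * β * (y.1 j - y.1 b) ^ 2)) := by
    fun_prop
  have hd : partialP b (transferObservable ω₂ lam β γ T N b j) x =
      partialP b ((pinnedChain ω₂ lam β γ).generator N T T
          ((pinnedChain ω₂ lam β γ).generator N T T (transferTest β N b j))) x
        - γ * partialP b ((pinnedChain ω₂ lam β γ).generator N T T (transferTest β N b j)) x
        + (ω₂ + 3 * lam * x.1 b ^ 2 + (1 + 3 * β * (x.1 j - x.1 b) ^ 2)) *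
          partialP b (transferTest β N b j) x := by
    have hsplit : transferObservable ω₂ lam β γ T N b j =
        (fun y => (pinnedChain ω₂ lam β γ).generator N T T
            ((pinnedChain ω₂ lam β γ).generator N T T (transferTest β N b j)) y
          - γ * (pinnedChain ω₂ lam β γ).generator N T T (transferTest β N b j) y)
        + (fun y => (ω₂ + 3 * lam * y.1 b ^ 2 + (1 + 3 * β * (y.1 j - y.1 b) ^ 2)) *
            transferTest β N b j y) := rfl
    have d1 : Differentiable ℝ (fun y => (pinnedChain ω₂ lam β γ).generator N T T
        ((pinnedChain ω₂ lam β γ).generator N T T (transferTest β N b j)) y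
          - γ * (pinnedChain ω₂ lam β γ).generator N T T (transferTest β N b j) y) :=
      dLL.sub (dL.const_mul γ)
    have d2 : Differentiable ℝ (fun y : PhaseSpace N =>
        (ω₂ + 3 * lam * y.1 b ^ 2 + (1 + 3 * β * (y.1 j - y.1 b) ^ 2)) * transferTest β N b j y) :=
      dκ.mul dψ
    rw [hsplit, partialP_add d1 d2, partialP_sub dLL (dL.const_mul γ) b x, partialP_const_mul, hκψ]
  have e1 : adjointP T b (transferObservable ω₂ lam β γ T N b j) x =
      adjointP T b ((pinnedChain ω₂ lam β γ).generator N T T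
          ((pinnedChain ω₂ lam β γ).generator N T T (transferTest β N b j))) x
        - γ * adjointP T b ((pinnedChain ω₂ lam β γ).generator N T T (transferTest β N b j)) x
        + (ω₂ + 3 * lam * x.1 b ^ 2 + (1 + 3 * β * (x.1 j - x.1 b) ^ 2)) *
          adjointP T b (transferTest β N b j) x := by
    simp only [adjointP]
    rw [hd]
    simp only [transferObservable]
    ring
  -- (2) (C1) at `f = Lψ`, (3) (C2) at `f = ψ`, (4) the Hessian column of `b`
  have e2 := adjointP_generator_comm ω₂ lam β γ hT hLψ b x
  rw [hB] at e2
  have e3 := adjointQ_generator_comm ω₂ lam β γ T hψ3 b x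
  have e4 : ∑ i, (pinnedChain ω₂ lam β γ).hessPotential N i b x.1 * adjointP T i (transferTest β N b j) x =
      (ω₂ + 3 * lam * x.1 b ^ 2 + (1 + 3 * β * (x.1 j - x.1 b) ^ 2)) * adjointP T b (transferTest β N b j) x
        - (1 + 3 * β * (x.1 j - x.1 b) ^ 2) * adjointP T j (transferTest β N b j) x := hcol _
  -- (5) `V″ · A_j ψ = p_j²/T − 1`
  have hdj : partialP j (transferTest β N b j) x = 1 / (1 + 3 * β * (x.1 j - x.1 b) ^ 2) := by
    unfold partialP
    show deriv (fun t => Function.update x.2 j t j / (1 + 3 * β * (x.1 j - x.1 b) ^ 2)) (x.2 j) = _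
    simp only [Function.update_self]
    rw [deriv_div_const, deriv_id'']
  have e5 : (1 + 3 * β * (x.1 j - x.1 b) ^ 2) * adjointP T j (transferTest β N b j) x = x.2 j ^ 2 / T - 1 := by
    simp only [adjointP]
    rw [hdj]
    simp only [transferTest]
    field_simp
  -- (6) linearity of `L` on `G = A_b(Lψ) + B_b ψ`
  have hA2 : ContDiff ℝ 2 (adjointP T b ((pinnedChain ω₂ lam β γ).generator N T T (transferTest β N b j))) :=
    contDiff_adjointP hLψ (by norm_num) T b
  have hB2 : ContDiff ℝ 2 (adjointQ (pinnedChain ω₂ lam β γ) T b (transferTest β N b j)) :=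
    contDiff_adjointQ ω₂ lam β γ hψ3 (by norm_num) T b
  rw [generator_add _ N T T hA2 hB2 x]
  linarith [e1, e2, e3, e4, e5]

/-- **(C3), hot clause** (`N ≥ 3`, sites `0, 1`): with `ψ = transferTest β N 0 1`, `Ψ = transferObservable … 0 1`,
`G = A_0(Lψ) + B_0 ψ`:  `p_1²/T − 1 = A_0 Ψ − L G` pointwise. [calculus] -/
theorem transferBracket_pointwise_hot (ω₂ lam β γ : ℝ) {T : ℝ} (hT : T ≠ 0) (hβ : 0 ≤ β) (hN : 3 ≤ N)
    (x : PhaseSpace N) :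
    x.2 ⟨1, by omega⟩ ^ 2 / T - 1 =
      adjointP T ⟨0, by omega⟩ (transferObservable ω₂ lam β γ T N ⟨0, by omega⟩ ⟨1, by omega⟩) x
        - (pinnedChain ω₂ lam β γ).generator N T T (fun y =>
            adjointP T ⟨0, by omega⟩ ((pinnedChain ω₂ lam β γ).generator N T T
                (transferTest β N ⟨0, by omega⟩ ⟨1, by omega⟩)) y
              + adjointQ (pinnedChain ω₂ lam β γ) T ⟨0, by omega⟩
                (transferTest β N ⟨0, by omega⟩ ⟨1, by omega⟩) y) x := by
  have hB : OscillatorChain.bathWeight N (⟨0, by omega⟩ : Fin N) = 1 := by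
    have h : (0 : ℕ) ≠ N - 1 := by omega
    simp [OscillatorChain.bathWeight, h]
  exact transferBracket_pointwise ω₂ lam β γ hT hβ ⟨0, by omega⟩ ⟨1, by omega⟩ hB x
    fun a => sum_hessPotential_col_zero_mul ω₂ lam β γ (by omega) x.1 a

/-- **(C3), cold clause** (`N ≥ 3`, sites `N−1, N−2`): with `ψ' = transferTest β N (N−1) (N−2)`,
`Ψ' = transferObservable … (N−1) (N−2)`, `G' = A_{N−1}(Lψ') + B_{N−1} ψ'`:
`p²_{N−2}/T − 1 = A_{N−1} Ψ' − L G'` pointwise. [calculus] -/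
theorem transferBracket_pointwise_cold (ω₂ lam β γ : ℝ) {T : ℝ} (hT : T ≠ 0) (hβ : 0 ≤ β) (hN : 3 ≤ N)
    (x : PhaseSpace N) :
    x.2 ⟨N - 1 - 1, by omega⟩ ^ 2 / T - 1 =
      adjointP T ⟨N - 1, by omega⟩
          (transferObservable ω₂ lam β γ T N ⟨N - 1, by omega⟩ ⟨N - 1 - 1, by omega⟩) x
        - (pinnedChain ω₂ lam β γ).generator N T T (fun y =>
            adjointP T ⟨N - 1, by omega⟩ ((pinnedChain ω₂ lam β γ).generator N T T
                (transferTest β N ⟨N - 1, by omega⟩ ⟨N - 1 - 1, by omega⟩)) y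
              + adjointQ (pinnedChain ω₂ lam β γ) T ⟨N - 1, by omega⟩
                (transferTest β N ⟨N - 1, by omega⟩ ⟨N - 1 - 1, by omega⟩) y) x := by
  have hB : OscillatorChain.bathWeight N (⟨N - 1, by omega⟩ : Fin N) = 1 := by
    have h : N - 1 ≠ 0 := by omega
    simp [OscillatorChain.bathWeight, h]
  exact transferBracket_pointwise ω₂ lam β γ hT hβ ⟨N - 1, by omega⟩ ⟨N - 1 - 1, by omega⟩ hB x
    fun a => sum_hessPotential_col_last_mul ω₂ lam β γ (by omega) x.1 a

end EscapeGrading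

end Summit.AtomisticToContinuum.FouriersLaw.Theorems.SubdiffusiveBondHeat

end
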